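import Summits.QuantumFields.YangMills.Theses.LuscherReduction
import Summits.QuantumFields.YangMills.Theorems.FemtoTransferGapBounds
import Summits.QuantumFields.YangMills.Theorems.FemtoTransferGapPositivity
import Summits.QuantumFields.YangMills.Theorems.FemtoTransferGapReduction
import Summits.QuantumFields.YangMills.Theorems.FemtoTransferGapSlabRayleigh
import Summits.QuantumFields.YangMills.Theorems.LuscherReductionOneSiteLevelsVariational
import Summits.QuantumFields.YangMills.Theorems.LuscherReductionRunningReductionKTDoor

/-!
# Crux RED, line «KTR»: NON-VACUITY CERTIFICATE for the rev-3 stub `DressedRitz` — it is IMPLIED by `RunningReduction`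
# (given exact zero-flux eigenfunctions at fixed lattice), kernel-checked

Fleet-service module of seat ym-infvol-p2 g4 for `stmt-QuantumFields-19978` (route `LuscherReduction`, crux RED
`RunningReduction`), line of record «KTR» (`pub/ym-beyond/p1-g16-files/Lines-KTR.lean` rev 2, sha16 3cffefe53154727e;
stubs `stub_coarseHandoverUpper2` 3a′, `stub_coarseNoIntruderAt2` 3b′, `stub_dressedRitz`, `stub_oneSiteLowerCoarse`).

HISTORY (why this file exists).  The rev-2 text of `stub_dressedRitz` was UNSATISFIABLE beyond the ground multiplet (its clause
(ii) bounded the total two-step variance over the whole dressed span by `C(λ³/L²)m₀²`, which the in-span spread of any two Ritz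
vectors violates — located by planner ym-cruxidea-19978-1 g3, kernel-checked `quarter_spread_sq_le_of_variance`, confirmed by the
owner 02:12Z 2026-08-27), so the compositions of «KT»/«KTH» were vacuous there.  The owner's repair (rev 3, adopted in «KTR»)
replaced (ii) by the RESIDUAL Gram bound (ii′) and asserted informally: «RED ∧ (spectral layer) ⟹ DressedRitz (exact
eigenfunctions: `r_i = 0`)».  THIS FILE KERNEL-CHECKS THAT ASSERTION: `dressedRitz_of_runningReduction` proves the VERBATIM rev-3
text of `DressedRitz` (inlined as the theorem's type, KTDoorR3 fast-lane precedent p486020 — the skeleton lives in a pub folder and is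
not importable) from

* the crux `Summit.QuantumFields.YangMills.Theses.LuscherReduction.RunningReduction` BY NAME, and
* SPECTRAL ATTAINMENT at fixed lattice (inline hypothesis `hatt`): for every `(L, β, k)` with `1 ≤ β` there is a physical,
  `l2`-orthonormal family `φ₀ … φ_k` of EXACT eigenfunctions of the zero-flux transfer operator, `K_β φ_j = λ_j φ_j` pointwise with
  `λ_j = levelValue su2Rep L β j` — the Hilbert–Schmidt theorem + min–max (Reed–Simon I Thm. VI.16, IV Thm. XIII.1–2) for the
  compact positive self-adjoint kernel operator `K_β` on the physical subspace of `L²(configMeasure)`; the abstract half is the tree's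
  `Literature/Analysis/OperatorTheory/CompactPositiveMinMaxLevels.lean` / `…EigenSequence.lean`, the bridge to `levelValue` is not
  yet in the tree (it is this seat's next target), hence a HYPOTHESIS here, stated over tree declarations only.

So, modulo attainment, every clause of the repaired witness stub is a consequence of the crux it serves: (i) Ritz ratios = RED's two
product inequalities at each level `j ≤ k` (one constant for all `j ≤ k`: `runningReduction_uniform`); (ii′) the residual
`Σ c_i (K_βφ_i − m_iφ_i)` is the ZERO FUNCTION (`residual_eq_zero`), so its Gram form is `0 ≤ C(λ³/L²)m₀²Σc_i²`; (iii) top capture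
`⟨ψ,K_βψ⟩ ≤ e^{ηλ/L} m₀‖ψ‖²` from `m₀ = λ₀` and the trial bound `qform_le_levelValue_zero_mul`; diagonality / antitonicity from the
eigen-equation and the NEW basic lemma `levelValue_succ_le` (`λ_{k+1} ≤ λ_k`: one more constraint — the zero function — never raises
the constrained supremum).  The line «KTR» is therefore NOT over-strong at `stub_dressedRitz`: the stub is RED-hard, not false.

HONEST FRAMING: fixed-lattice linear algebra over tree objects; proves NOTHING of RED, of 3a′/3b′, or of attainment; femto rung R2b1
(`FemtoGapOfRecord`) bookkeeping only — no bearing on infinite volume, the continuum limit or the Clay mass gap.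
-/

set_option autoImplicit false

noncomputable section

open MeasureTheory Filter Topology Real
open Literature.MathematicalPhysics.QuantumFieldTheory
open Literature.MathematicalPhysics.QuantumLattice
open Literature.Analysis.OperatorTheory.YMMatrixModel
open scoped BigOperators

namespace Summit.QuantumFields.YangMills.Theorems.FemtoTransferGap.KTRCalibration

open Summit.QuantumFields.YangMills.Theorems.FemtoTransferGap

variable {L : ℕ} [NeZero L]

/-! ## §1 `λ_{k+1} ≤ λ_k`: the min–max transfer values are non-increasing in the level -/

/-- `⟨ψ, 0⟩ = 0`. [folklore] -/
theorem l2_zero_right (ψ : GaugeConfig 3 L SU2 → ℝ) : l2 ψ (fun _ => (0 : ℝ)) = 0 := by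
  unfold l2
  simp

/-- Adding the zero function as a `(k+1)`-st constraint does not change the constrained Rayleigh set. [cite: ReedSimonIV1978, Thm. XIII.1] -/
theorem rayleighSet_snocZero (β : ℝ) {k : ℕ} (φs : Fin k → (GaugeConfig 3 L SU2 → ℝ)) :
    rayleighSet su2Rep L β (fun ψ => ∀ i : Fin (k + 1),
        l2 ψ ((fun i : Fin (k + 1) => if h : (i : ℕ) < k then φs ⟨i, h⟩ else fun _ => (0 : ℝ)) i) = 0) =
      rayleighSet su2Rep L β (fun ψ => ∀ i : Fin k, l2 ψ (φs i) = 0) := by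
  have hP : (fun ψ : GaugeConfig 3 L SU2 → ℝ => ∀ i : Fin (k + 1),
        l2 ψ ((fun i : Fin (k + 1) => if h : (i : ℕ) < k then φs ⟨i, h⟩ else fun _ => (0 : ℝ)) i) = 0) =
      (fun ψ => ∀ i : Fin k, l2 ψ (φs i) = 0) := by
    funext ψ
    apply propext
    constructor
    · intro h i
      have hi := h ⟨i, Nat.lt_succ_of_lt i.2⟩
      simp only [Fin.is_lt, ↓reduceDIte, Fin.eta] at hi
      exact hi
    · intro h i
      by_cases hi : (i : ℕ) < k
      · simp only [hi, ↓reduceDIte]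
        exact h ⟨i, hi⟩
      · simp only [hi, ↓reduceDIte]
        exact l2_zero_right ψ
  rw [hP]

/-- **`λ_{k+1}(β,L) ≤ λ_k(β,L)`** for the `SU(2)` zero-flux transfer values (`β ≥ 0`): every `k`-constraint family extends by the zero
function to a `(k+1)`-constraint family with the same constrained supremum, so the infimum defining `λ_{k+1}` runs over a superset.
[cite: ReedSimonIV1978, Thm. XIII.1] -/
theorem levelValue_succ_le {β : ℝ} (hβ : 0 ≤ β) (k : ℕ) :
    levelValue su2Rep L β (k + 1) ≤ levelValue su2Rep L β k := by
  set Sk : Set ℝ := {s | ∃ φs : Fin k → (GaugeConfig 3 L SU2 → ℝ), (∀ i, IsPhys (φs i)) ∧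
    s = sSup (rayleighSet su2Rep L β fun ψ => ∀ i, l2 ψ (φs i) = 0)} with hSk
  set Sk1 : Set ℝ := {s | ∃ φs : Fin (k + 1) → (GaugeConfig 3 L SU2 → ℝ), (∀ i, IsPhys (φs i)) ∧
    s = sSup (rayleighSet su2Rep L β fun ψ => ∀ i, l2 ψ (φs i) = 0)} with hSk1
  have hk : levelValue su2Rep L β k = sInf Sk := by unfold levelValue; rfl
  have hk1 : levelValue su2Rep L β (k + 1) = sInf Sk1 := by unfold levelValue; rfl
  rw [hk, hk1]
  -- `Sk ⊆ Sk1`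
  have hsub : Sk ⊆ Sk1 := by
    rintro s ⟨φs, hφ, rfl⟩
    refine ⟨fun i : Fin (k + 1) => if h : (i : ℕ) < k then φs ⟨i, h⟩ else fun _ => (0 : ℝ), fun i => ?_, ?_⟩
    · by_cases hi : (i : ℕ) < k
      · simp only [hi, ↓reduceDIte]; exact hφ _
      · simp only [hi, ↓reduceDIte]; exact isPhys_const 0
    · rw [rayleighSet_snocZero]
  have hne : Sk.Nonempty := ⟨_, fun _ _ => (1 : ℝ), fun _ => isPhys_const 1, rfl⟩
  have hbdd : BddBelow Sk1 := by
    refine ⟨0, fun s hs => ?_⟩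
    obtain ⟨φs, -, rfl⟩ := hs
    refine Real.sSup_nonneg ?_
    rintro r ⟨ψ, hψ, -, hpos, rfl⟩
    exact div_nonneg (qform_su2Rep_self_nonneg hβ hψ) hpos.le
  exact csInf_le_csInf hbdd hne hsub

/-- `λ_·(β,L)` is antitone in the level. [cite: ReedSimonIV1978, Thm. XIII.1] -/
theorem levelValue_antitone {β : ℝ} (hβ : 0 ≤ β) : Antitone (fun k => levelValue su2Rep L β k) :=
  antitone_nat_of_succ_le fun k => levelValue_succ_le hβ k

/-! ## §2 Exact eigenfamilies: Ritz values, diagonality, vanishing residual -/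

section Exact

variable {β : ℝ} {k : ℕ} {φ : Fin (k + 1) → (GaugeConfig 3 L SU2 → ℝ)}

/-- For an exact eigenfamily `K_βφ_l = λ_lφ_l`: `⟨φ_i, K_βφ_l⟩ = λ_l ⟨φ_i, φ_l⟩`. [cite: ReedSimonI1980, Thm. VI.16] -/
theorem qform_of_eigen (heig : ∀ i, transferApply β (φ i) = levelValue su2Rep L β i • φ i) (i l : Fin (k + 1)) :
    qform su2Rep β (φ i) (φ l) = levelValue su2Rep L β l * l2 (φ i) (φ l) := by
  rw [qform_eq_l2_transferApply, heig l, l2_comm, l2_smul_left, l2_comm]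

/-- Exact orthonormal eigenfamily: `⟨φ_i, K_βφ_l⟩ = λ_l δ_{il}`. [cite: ReedSimonI1980, Thm. VI.16] -/
theorem qform_of_eigen_orthonormal (hon : ∀ i l, l2 (φ i) (φ l) = if i = l then 1 else 0)
    (heig : ∀ i, transferApply β (φ i) = levelValue su2Rep L β i • φ i) (i l : Fin (k + 1)) :
    qform su2Rep β (φ i) (φ l) = if i = l then levelValue su2Rep L β l else 0 := by
  rw [qform_of_eigen heig, hon]
  split_ifs <;> simp

/-- The Ritz values of an exact orthonormal eigenfamily are the min–max values: `m_i = λ_i`. [cite: ReedSimonI1980, Thm. VI.16] -/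
theorem ritz_of_eigen (hon : ∀ i l, l2 (φ i) (φ l) = if i = l then 1 else 0)
    (heig : ∀ i, transferApply β (φ i) = levelValue su2Rep L β i • φ i) (i : Fin (k + 1)) :
    qform su2Rep β (φ i) (φ i) = levelValue su2Rep L β i := by
  rw [qform_of_eigen_orthonormal hon heig, if_pos rfl]

/-- The residual `Σ c_i (K_βφ_i − m_iφ_i)` of an exact orthonormal eigenfamily is the zero function. [cite: ReedSimonI1980, Thm. VI.16] -/
theorem residual_eq_zero (hon : ∀ i l, l2 (φ i) (φ l) = if i = l then 1 else 0)
    (heig : ∀ i, transferApply β (φ i) = levelValue su2Rep L β i • φ i) (c : Fin (k + 1) → ℝ) :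
    (∑ i, c i • (transferApply β (φ i) - qform su2Rep β (φ i) (φ i) • φ i)) = 0 := by
  refine Finset.sum_eq_zero fun i _ => ?_
  rw [heig i, ritz_of_eigen hon heig i, sub_self, smul_zero]

/-- `⟨0, 0⟩ = 0`. [folklore] -/
theorem l2_zero_zero : l2 (0 : GaugeConfig 3 L SU2 → ℝ) 0 = 0 := by
  unfold l2
  simp

end Exact

/-! ## §3 RED at all levels `j ≤ k` with one constant; nonnegativity bookkeeping -/

/-- `λ(β,L) ≥ 0` always (a real power of a nonnegative base). [folklore] -/
theorem luscherLambda_nonneg (β : ℝ) (L : ℕ) : 0 ≤ luscherLambda β L := by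
  unfold luscherLambda
  exact Real.rpow_nonneg (le_max_right _ _) _

/-- The effective one-site coupling is nonnegative (junk value `0` included). [folklore] -/
theorem oneSiteCoupling_nonneg (β : ℝ) (L : ℕ) : 0 ≤ oneSiteCoupling β L := by
  unfold oneSiteCoupling
  exact div_nonneg (by positivity) (pow_nonneg (luscherLambda_nonneg β L) 3)

/-- Monotonicity of RED's error factor in the constant: `X ≤ e^{C₁s/r}Y`, `s/r ≥ 0`, `Y ≥ 0`, `C₁ ≤ C` ⟹ `X ≤ e^{Cs/r}Y`. [folklore] -/
theorem le_exp_mul_div_of_le {X Y C₁ C s r : ℝ} (h : X ≤ Real.exp (C₁ * s / r) * Y) (hs : 0 ≤ s / r) (hY : 0 ≤ Y)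
    (hC : C₁ ≤ C) : X ≤ Real.exp (C * s / r) * Y := by
  refine h.trans (mul_le_mul_of_nonneg_right (Real.exp_le_exp.mpr ?_) hY)
  rw [mul_div_assoc, mul_div_assoc]
  exact mul_le_mul_of_nonneg_right hC hs

/-- **RED uniformly in the levels `j ≤ k`**: from `RunningReduction` (one constant per level) to one constant `C`, one `lam0` and one
`L0` serving all `j ≤ k` at once (finite maxima/minima, by induction on `k`). [cite: Luscher1983, §3] -/
theorem runningReduction_uniform (hRED : Summit.QuantumFields.YangMills.Theses.LuscherReduction.RunningReduction) (k : ℕ) :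
    ∃ C lam0 : ℝ, 0 < lam0 ∧ ∀ lam : ℝ, 0 < lam → lam ≤ lam0 → ∃ L0 : ℕ, ∀ (L : ℕ) [NeZero L], L0 ≤ L → ∀ β : ℝ,
      InFemtoWindow lam β L → ∀ j : ℕ, j ≤ k →
        levelValue su2Rep L β j * levelValue su2Rep 1 (oneSiteCoupling β L) 0 ≤
            Real.exp (C * luscherLambda β L ^ 2 / L) * (levelValue su2Rep 1 (oneSiteCoupling β L) j * levelValue su2Rep L β 0) ∧
          levelValue su2Rep 1 (oneSiteCoupling β L) j * levelValue su2Rep L β 0 ≤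
            Real.exp (C * luscherLambda β L ^ 2 / L) * (levelValue su2Rep L β j * levelValue su2Rep 1 (oneSiteCoupling β L) 0) := by
  induction k with
  | zero =>
    obtain ⟨C, lam0, hlam0, h⟩ := hRED 0
    refine ⟨C, lam0, hlam0, fun lam hlam hle => ?_⟩
    obtain ⟨L0, hL⟩ := h lam hlam hle
    refine ⟨L0, fun L _ hL0 β hW j hj => ?_⟩
    obtain rfl : j = 0 := Nat.le_zero.mp hj
    exact hL L hL0 β hW
  | succ k ih =>
    obtain ⟨C₁, lam₁, hlam₁, h₁⟩ := ih
    obtain ⟨C₂, lam₂, hlam₂, h₂⟩ := hRED (k + 1)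
    refine ⟨max C₁ C₂, min lam₁ lam₂, lt_min hlam₁ hlam₂, fun lam hlam hle => ?_⟩
    obtain ⟨L₁, hL₁⟩ := h₁ lam hlam (hle.trans (min_le_left _ _))
    obtain ⟨L₂, hL₂⟩ := h₂ lam hlam (hle.trans (min_le_right _ _))
    refine ⟨max L₁ L₂, fun L _ hL0 β hW j hj => ?_⟩
    have hβ : 0 ≤ β := zero_le_one.trans hW.1
    have hB : 0 ≤ oneSiteCoupling β L := oneSiteCoupling_nonneg β L
    have ht : 0 ≤ luscherLambda β L ^ 2 / L := div_nonneg (sq_nonneg _) (Nat.cast_nonneg L)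
    have hY₁ : ∀ j : ℕ, 0 ≤ levelValue su2Rep 1 (oneSiteCoupling β L) j * levelValue su2Rep L β 0 := fun j =>
      mul_nonneg (levelValue_su2Rep_nonneg 1 hB j) (levelValue_su2Rep_nonneg L hβ 0)
    have hY₂ : ∀ j : ℕ, 0 ≤ levelValue su2Rep L β j * levelValue su2Rep 1 (oneSiteCoupling β L) 0 := fun j =>
      mul_nonneg (levelValue_su2Rep_nonneg L hβ j) (levelValue_su2Rep_nonneg 1 hB 0)
    rcases Nat.lt_or_ge j (k + 1) with hjk | hjk
    · have hj' : j ≤ k := Nat.lt_succ_iff.mp hjk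
      obtain ⟨ha, hb⟩ := hL₁ L ((le_max_left _ _).trans hL0) β hW j hj'
      exact ⟨le_exp_mul_div_of_le ha ht (hY₁ j) (le_max_left C₁ C₂), le_exp_mul_div_of_le hb ht (hY₂ j) (le_max_left C₁ C₂)⟩
    · obtain rfl : j = k + 1 := le_antisymm hj hjk
      obtain ⟨ha, hb⟩ := hL₂ L ((le_max_right _ _).trans hL0) β hW
      exact ⟨le_exp_mul_div_of_le ha ht (hY₁ (k + 1)) (le_max_right C₁ C₂),
        le_exp_mul_div_of_le hb ht (hY₂ (k + 1)) (le_max_right C₁ C₂)⟩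

/-! ## §4 The certificate: `RunningReduction` ∧ attainment ⟹ `DressedRitz` (rev-3 text, VERBATIM) -/

/-- ★ **NON-VACUITY CERTIFICATE for `stub_dressedRitz` (line «KTR», rev-3 residual-Gram text).**  Assume SPECTRAL ATTAINMENT at fixed
lattice (`hatt`: for every `L, β ≥ 1, k`, a physical `l2`-orthonormal family of exact zero-flux eigenfunctions `K_βφ_j = λ_jφ_j`,
`λ_j = levelValue su2Rep L β j`, `j ≤ k` — Hilbert–Schmidt theorem + min–max, Reed–Simon I VI.16 / IV XIII.1–2, for the compact
positive self-adjoint kernel operator `K_β`; NOT proved here) and the crux RED `RunningReduction` BY NAME.  Then the statement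
`DressedRitz` of `pub/ym-beyond/p1-g16-files/Lines-KTR.lean` (rev 2, 3cffefe53154727e; = ideator-1's `Lines-KT-r3.lean` 354dc29e) holds —
the conclusion below is its text character for character.  Witnesses: the exact eigenfamily itself; `C := max C_RED 0` from
`runningReduction_uniform`; clause (ii′) holds because the residual is the zero function; clause (iii) with any `η > 0` because
`m₀ = λ₀`.  Consequently the repaired stub is implied by the crux it serves (modulo attainment): the line is not over-strong there.
[cite: ReedSimonIV1978, Thm. XIII.1] [cite: Luscher1983, §3] -/
theorem dressedRitz_of_runningReduction
    (hatt : ∀ (L : ℕ) [NeZero L] (β : ℝ) (k : ℕ), 1 ≤ β →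
      ∃ φ : Fin (k + 1) → (GaugeConfig 3 L SU2 → ℝ),
        (∀ i, IsPhys (φ i)) ∧
        (∀ i l, l2 (φ i) (φ l) = if i = l then 1 else 0) ∧
        (∀ i, transferApply β (φ i) = levelValue su2Rep L β i • φ i))
    (hRED : Summit.QuantumFields.YangMills.Theses.LuscherReduction.RunningReduction) :
    ∀ k : ℕ, ∀ η : ℝ, 0 < η → ∃ C lam0 : ℝ, 0 < lam0 ∧ ∀ lam : ℝ, 0 < lam → lam ≤ lam0 →
    ∃ L0 : ℕ, ∀ (L : ℕ) [NeZero L], L0 ≤ L → ∀ β : ℝ, InFemtoWindow lam β L →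
      ∃ φ : Fin (k + 1) → (GaugeConfig 3 L SU2 → ℝ),
        (∀ i, IsPhys (φ i)) ∧
        (∀ i l, l2 (φ i) (φ l) = if i = l then 1 else 0) ∧
        (∀ i l, i ≠ l → qform su2Rep β (φ i) (φ l) = 0) ∧
        (∀ i l : Fin (k + 1), i ≤ l → qform su2Rep β (φ l) (φ l) ≤ qform su2Rep β (φ i) (φ i)) ∧
        (∀ j : Fin (k + 1),
          qform su2Rep β (φ j) (φ j) * levelValue su2Rep 1 (oneSiteCoupling β L) 0 ≤
              Real.exp (C * luscherLambda β L ^ 2 / L) *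
                (levelValue su2Rep 1 (oneSiteCoupling β L) j * qform su2Rep β (φ 0) (φ 0)) ∧
            levelValue su2Rep 1 (oneSiteCoupling β L) j * qform su2Rep β (φ 0) (φ 0) ≤
              Real.exp (C * luscherLambda β L ^ 2 / L) *
                (qform su2Rep β (φ j) (φ j) * levelValue su2Rep 1 (oneSiteCoupling β L) 0)) ∧
        (∀ c : Fin (k + 1) → ℝ,
          l2 (∑ i, c i • (transferApply β (φ i) - qform su2Rep β (φ i) (φ i) • φ i))
             (∑ i, c i • (transferApply β (φ i) - qform su2Rep β (φ i) (φ i) • φ i)) ≤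
            C * (luscherLambda β L ^ 3 / (L : ℝ) ^ 2) * qform su2Rep β (φ 0) (φ 0) ^ 2 * ∑ i, c i ^ 2) ∧
        (∀ ψ : GaugeConfig 3 L SU2 → ℝ, IsPhys ψ →
          qform su2Rep β ψ ψ ≤ Real.exp (η * luscherLambda β L / L) * qform su2Rep β (φ 0) (φ 0) * l2 ψ ψ) := by
  intro k η hη
  obtain ⟨C, lam0, hlam0, hC⟩ := runningReduction_uniform hRED k
  refine ⟨max C 0, lam0, hlam0, fun lam hlam hle => ?_⟩
  obtain ⟨L0, hL⟩ := hC lam hlam hle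
  refine ⟨L0, fun L _ hL0 β hW => ?_⟩
  have hβ1 : 1 ≤ β := hW.1
  have hβ : 0 ≤ β := zero_le_one.trans hβ1
  have hB : 0 ≤ oneSiteCoupling β L := oneSiteCoupling_nonneg β L
  have hlam_nn : 0 ≤ luscherLambda β L := luscherLambda_nonneg β L
  have ht : 0 ≤ luscherLambda β L ^ 2 / L := div_nonneg (sq_nonneg _) (Nat.cast_nonneg L)
  obtain ⟨φ, hφ, hon, heig⟩ := hatt L β k hβ1
  have hritz : ∀ i : Fin (k + 1), qform su2Rep β (φ i) (φ i) = levelValue su2Rep L β i := ritz_of_eigen hon heig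
  have hm0 : qform su2Rep β (φ 0) (φ 0) = levelValue su2Rep L β 0 := by rw [hritz 0, Fin.val_zero]
  have hlv0 : 0 ≤ levelValue su2Rep L β 0 := levelValue_su2Rep_nonneg L hβ 0
  refine ⟨φ, hφ, hon, fun i l hil => ?_, fun i l hil => ?_, fun j => ?_, fun c => ?_, fun ψ hψ => ?_⟩
  · -- (c) `qform`-diagonal
    rw [qform_of_eigen_orthonormal hon heig, if_neg hil]
  · -- (d) antitone Ritz values
    rw [hritz, hritz]
    exact levelValue_antitone hβ (Fin.le_def.mp hil)
  · -- (i) Ritz ratios = one-site ratios to `e^{±Cλ²/L}`: RED at level `j`, constant upgraded to `max C 0`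
    rw [hritz j, hm0]
    obtain ⟨ha, hb⟩ := hL L hL0 β hW j (Nat.lt_succ_iff.mp j.2)
    have hY₁ : 0 ≤ levelValue su2Rep 1 (oneSiteCoupling β L) j * levelValue su2Rep L β 0 :=
      mul_nonneg (levelValue_su2Rep_nonneg 1 hB j) hlv0
    have hY₂ : 0 ≤ levelValue su2Rep L β j * levelValue su2Rep 1 (oneSiteCoupling β L) 0 :=
      mul_nonneg (levelValue_su2Rep_nonneg L hβ j) (levelValue_su2Rep_nonneg 1 hB 0)
    exact ⟨le_exp_mul_div_of_le ha ht hY₁ (le_max_left C 0), le_exp_mul_div_of_le hb ht hY₂ (le_max_left C 0)⟩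
  · -- (ii′) residual Gram bound: the residual is the zero function
    rw [residual_eq_zero hon heig c, l2_zero_zero]
    have h1 : 0 ≤ max C 0 * (luscherLambda β L ^ 3 / (L : ℝ) ^ 2) :=
      mul_nonneg (le_max_right _ _) (div_nonneg (pow_nonneg hlam_nn 3) (sq_nonneg _))
    exact mul_nonneg (mul_nonneg h1 (sq_nonneg _)) (Finset.sum_nonneg fun i _ => sq_nonneg (c i))
  · -- (iii) top capture with `m₀ = λ₀`
    rw [hm0]
    have hexp : 1 ≤ Real.exp (η * luscherLambda β L / L) :=
      Real.one_le_exp (div_nonneg (mul_nonneg hη.le hlam_nn) (Nat.cast_nonneg L))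
    have hl2 : 0 ≤ l2 ψ ψ := l2_self_nonneg ψ
    rcases hl2.eq_or_lt with h0 | hpos
    · rw [← h0, mul_zero, qform_eq_zero_of_l2_eq_zero β hψ h0.symm]
    · calc qform su2Rep β ψ ψ ≤ levelValue su2Rep L β 0 * l2 ψ ψ :=
            qform_le_levelValue_zero_mul su2Rep continuous_su2Rep β hψ hpos
        _ = 1 * levelValue su2Rep L β 0 * l2 ψ ψ := by rw [one_mul]
        _ ≤ Real.exp (η * luscherLambda β L / L) * levelValue su2Rep L β 0 * l2 ψ ψ :=
            mul_le_mul_of_nonneg_right (mul_le_mul_of_nonneg_right hexp hlv0) hl2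

end Summit.QuantumFields.YangMills.Theorems.FemtoTransferGap.KTRCalibration

end
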